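import Literature.MathematicalPhysics.KineticTheory.HardSphereEulerLLN
import HarnessLib

/-!
# General `(ε_N, n_N)` families of the canonical hard-sphere gas, I: uniform bounds and the deterministic estimate

Support file for the crux `…Theses.RelayRaceLocality.NearConstantShortTimeHL` (stmt-AtomisticToContinuum-12502),
line `means-pin-entropy`, registered stub `stub_concentrationGeneralFamilies : GeneralFamilyConcentration`
(exponential concentration of the empirical fields under matched canonical local Gibbs laws for GENERAL
diameter/number families `ε_N → 0`, `n_N ε_N³ → σ³`). The tree's low-density expansion of the canonical
hard-sphere gas (`HardSphereCanonicalTorus`, `HardSphereEulerRatio`, `HardSphereEulerLLN`) is written along the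
CONJUNCT scaling `(hsDiameter σ N, N + 1)`; its base objects `Xi P ε n m`, `Wd P ε n g k`, `Md P ε n g m` are
general in `(ε, n)`, and this file re-proves, at a FIXED pair `(ε, n)` under the explicit smallness `n · p_ε ≤ λ`
(`p_ε = M v₁ ε³`), the uniform bounds of `HardSphereEulerRatio` and the deterministic step of its contraction
argument (registered helper `gf_abs_inv_q_sub_inv_le`):

* `gf_Xi_mul_le_succ`, `gf_Xi_pos`, `gf_one_le_q`, `gf_q_le` — insertion bound, positivity of the partition
  functions, `1 ≤ Ξ(m)/Ξ(m+1) ≤ (1-λ)⁻¹`;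
* `gf_r_succ`, `gf_one_le_r`, `gf_r_le`, `gf_r_le_two_pow`, `gf_abs_r_sub_pow_le` — the products of ratios
  `Ξ(m-j)/Ξ(m)`;
* `gf_inv_q_eq_sum` — the ratio identity `Ξ(m+1)/Ξ(m) = ∑_j C(m,j) W¹(j+1) Ξ(m-j)/Ξ(m)`;
* `gf_abs_coef_le` — `|C(m,j) W^g(j+1)| ≤ C e (eλ)ʲ`;
* `gf_slack_numerics` — the slack regime `θ₊ = 2eλ ≤ 1/14` (contraction factor `4eθ₊/(1-θ₊)² < 1`);
* `gf_abs_inv_q_sub_inv_le` — if `|Ξ(m-1-i)/Ξ(m-i) - R| ≤ η` (`i < J`) and `|C(m,j)W¹(j+1) - γ_j∫β^{j+1}| ≤ τ`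
  (`j ≤ J`), `R = ratioLimit P σ`, then `|Ξ(m+1)/Ξ(m) - R⁻¹| ≤ (J+1)2ᴶτ + κ₊η + 2eθ₊^{J+1}/(1-θ₊)`.

No definitions. Sources: E. Pulvirenti – D. Tsagkarogiannis, Comm. Math. Phys. 316 (2012) Thm 2.1, §3–5;
H. Spohn, Large Scale Dynamics of Interacting Particles (1991), Part I §2.3.
-/

noncomputable section

namespace Summit.AtomisticToContinuum.HydrodynamicLimit.Theorems.NearConstantShortTimeHL

open MeasureTheory ProbabilityTheory Finset Filter Topology
open scoped ENNReal
open Literature.MathematicalPhysics.KineticTheory Literature.MathematicalPhysics.StatisticalMechanics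
open Literature.Probability.LatticeModels

/-! ### Uniform bounds at a fixed scale `ε` and particle number `n` with `n p_ε ≤ λ` -/

section Bounds

variable {P : DensityProfile} {e lam : ℝ} {n : ℕ}
  (he : 0 ≤ e) (he2 : e < 1 / 2) (hnp : (n : ℝ) * pOv P e ≤ lam)
include he he2 hnp

/-- **Insertion bound**: `Ξ(m) (1 - λ) ≤ Ξ(m+1)` for `m < n` when `n p_ε ≤ λ`. [folklore] -/
theorem gf_Xi_mul_le_succ {m : ℕ} (hm : m < n) : Xi P e n m * (1 - lam) ≤ Xi P e n (m + 1) := by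
  have h := Xi_succ_ge (P := P) (n := n) he he2 hm
  refine le_trans (mul_le_mul_of_nonneg_left ?_ (Xi_nonneg _)) h
  have hp : 0 ≤ pOv P e := pOv_nonneg P he
  have h1 : (m : ℝ) * pOv P e ≤ (n : ℝ) * pOv P e :=
    mul_le_mul_of_nonneg_right (by exact_mod_cast hm.le) hp
  linarith

omit he he2 in
/-- `0 ≤ λ` (from `0 ≤ n p_ε ≤ λ`). [folklore] -/
theorem gf_lam_nonneg (he : 0 ≤ e) : 0 ≤ lam :=
  le_trans (mul_nonneg (Nat.cast_nonneg n) (pOv_nonneg P he)) hnp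

/-- **Uniform bound on the coefficients**: `|C(m, j) W^g(j+1)| ≤ C e (e λ)ʲ` for `|g| ≤ C`, `j < n`, `m ≤ n`
(tree bound `abs_Wd_le`, `C(m, j) ≤ mʲ/j!`, `m p_ε ≤ λ`). [folklore] -/
theorem gf_abs_coef_le [NeZero n] {g : T3 → ℝ} (hg : Measurable g) {C : ℝ} (hgC : ∀ y, |g y| ≤ C)
    {m j : ℕ} (hj : j < n) (hm : m ≤ n) :
    |(m.choose j : ℝ) * Wd P e n g (j + 1)| ≤ C * (Real.exp 1 * (Real.exp 1 * lam) ^ j) := by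
  have hC : 0 ≤ C := (abs_nonneg _).trans (hgC 0)
  have hp : 0 ≤ pOv P e := pOv_nonneg P he
  have hlam0 : 0 ≤ lam := gf_lam_nonneg hnp he
  have hW := abs_Wd_le (P := P) (n := n) he he2 hg hgC (k := j + 1) (by omega) (by omega)
  rw [Nat.add_sub_cancel] at hW
  have hchoose : (m.choose j : ℝ) ≤ (m : ℝ) ^ j / j.factorial := Nat.choose_le_pow_div j m
  have hmp : (m : ℝ) * pOv P e ≤ lam :=
    le_trans (mul_le_mul_of_nonneg_right (by exact_mod_cast hm) hp) hnp
  have hmp0 : 0 ≤ (m : ℝ) * pOv P e := by positivity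
  rw [abs_mul, Nat.abs_cast]
  calc (m.choose j : ℝ) * |Wd P e n g (j + 1)|
      ≤ ((m : ℝ) ^ j / j.factorial) * (C * (treeNumber (j + 1) * pOv P e ^ j)) :=
        mul_le_mul hchoose hW (abs_nonneg _) (by positivity)
    _ = C * ((treeNumber (j + 1) : ℝ) * ((m : ℝ) * pOv P e) ^ j / j.factorial) := by
        rw [mul_pow]; ring
    _ ≤ C * ((treeNumber (j + 1) : ℝ) * lam ^ j / j.factorial) := by
        gcongr
    _ ≤ C * (Real.exp 1 * (Real.exp 1 * lam) ^ j) :=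
        mul_le_mul_of_nonneg_left (treeNumber_succ_mul_pow_div_factorial_le hlam0 j) hC

variable (hlam1 : lam < 1)
include hlam1

/-- **Positivity of the partition functions**: `0 < Ξ(m)` for `m ≤ n`. [folklore] -/
theorem gf_Xi_pos {m : ℕ} (hm : m ≤ n) : 0 < Xi P e n m := by
  induction m with
  | zero => rw [Xi_zero]; exact one_pos
  | succ m ih =>
      have h := gf_Xi_mul_le_succ he he2 hnp (m := m) (by omega)
      exact lt_of_lt_of_le (mul_pos (ih (by omega)) (by linarith)) h

/-- `1 ≤ Ξ(m)/Ξ(m+1)` for `m < n`. [folklore] -/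
theorem gf_one_le_q {m : ℕ} (hm : m < n) : 1 ≤ Xi P e n m / Xi P e n (m + 1) := by
  rw [one_le_div (gf_Xi_pos he he2 hnp hlam1 (by omega))]
  exact Xi_succ_le _

/-- `Ξ(m)/Ξ(m+1) ≤ (1 - λ)⁻¹` for `m < n`. [folklore] -/
theorem gf_q_le {m : ℕ} (hm : m < n) : Xi P e n m / Xi P e n (m + 1) ≤ (1 - lam)⁻¹ := by
  rw [div_le_iff₀ (gf_Xi_pos he he2 hnp hlam1 (by omega)), ← div_eq_inv_mul,
    le_div_iff₀ (by linarith)]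
  exact gf_Xi_mul_le_succ he he2 hnp hm

/-- `Ξ(m-0)/Ξ(m) = 1`. [folklore] -/
theorem gf_r_zero {m : ℕ} (hm : m ≤ n) : Xi P e n (m - 0) / Xi P e n m = 1 := by
  rw [Nat.sub_zero, div_self (gf_Xi_pos he he2 hnp hlam1 hm).ne']

/-- The recursion `Ξ(m-(j+1))/Ξ(m) = (Ξ(m-j)/Ξ(m)) · (Ξ(m-1-j)/Ξ(m-j))` for `j + 1 ≤ m ≤ n`. [folklore] -/
theorem gf_r_succ {m j : ℕ} (hm : m ≤ n) (hj : j + 1 ≤ m) :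
    Xi P e n (m - (j + 1)) / Xi P e n m =
      Xi P e n (m - j) / Xi P e n m * (Xi P e n (m - 1 - j) / Xi P e n (m - 1 - j + 1)) := by
  have h1 : m - 1 - j + 1 = m - j := by omega
  have h2 : m - (j + 1) = m - 1 - j := by omega
  rw [h1, h2, div_mul_div_comm, mul_comm (Xi P e n (m - j)),
    mul_div_mul_right _ _ (gf_Xi_pos he he2 hnp hlam1 (by omega : m - j ≤ n)).ne']

/-- `1 ≤ Ξ(m-j)/Ξ(m)` for `j ≤ m ≤ n`. [folklore] -/
theorem gf_one_le_r {m j : ℕ} (hm : m ≤ n) (hj : j ≤ m) : 1 ≤ Xi P e n (m - j) / Xi P e n m := by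
  induction j with
  | zero => rw [gf_r_zero he he2 hnp hlam1 hm]
  | succ j ih =>
      rw [gf_r_succ he he2 hnp hlam1 hm hj]
      exact one_le_mul_of_one_le_of_one_le (ih (by omega)) (gf_one_le_q he he2 hnp hlam1 (by omega))

/-- `Ξ(m-j)/Ξ(m) ≤ (1 - λ)^{-j}` for `j ≤ m ≤ n`. [folklore] -/
theorem gf_r_le {m j : ℕ} (hm : m ≤ n) (hj : j ≤ m) :
    Xi P e n (m - j) / Xi P e n m ≤ (1 - lam)⁻¹ ^ j := by
  induction j with
  | zero => rw [gf_r_zero he he2 hnp hlam1 hm, pow_zero]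
  | succ j ih =>
      rw [gf_r_succ he he2 hnp hlam1 hm hj, pow_succ]
      have h0 : 0 ≤ Xi P e n (m - 1 - j) / Xi P e n (m - 1 - j + 1) :=
        zero_le_one.trans (gf_one_le_q he he2 hnp hlam1 (by omega))
      exact mul_le_mul (ih (by omega)) (gf_q_le he he2 hnp hlam1 (by omega)) h0
        (pow_nonneg (inv_nonneg.2 (by linarith)) _)

omit he he2 hnp hlam1 in
/-- **The ratio identity** (the recursion for `Ξ` divided by `Ξ(m)`):
`Ξ(m+1)/Ξ(m) = ∑_{j ≤ m} C(m, j) W¹(j+1) Ξ(m-j)/Ξ(m)` for `m < n`. [folklore] -/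
theorem gf_inv_q_eq_sum [NeZero n] {m : ℕ} (hm : m < n) :
    (Xi P e n m / Xi P e n (m + 1))⁻¹ =
      ∑ j ∈ range (m + 1), ((m.choose j : ℝ) * Wd P e n (fun _ => 1) (j + 1)) *
        (Xi P e n (m - j) / Xi P e n m) := by
  rw [inv_div, Xi_eq_sum (P := P) (n := n) (m := m + 1) (by omega) (by omega), sum_div]
  refine sum_congr rfl fun j _ => ?_
  rw [show m + 1 - 1 = m from rfl]
  ring

/-- `Ξ(m-j)/Ξ(m) ≤ 2ʲ` when moreover `λ ≤ 1/2`. [folklore] -/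
theorem gf_r_le_two_pow (hlam2 : lam ≤ 1 / 2) {m j : ℕ} (hm : m ≤ n) (hj : j ≤ m) :
    Xi P e n (m - j) / Xi P e n m ≤ 2 ^ j := by
  refine (gf_r_le he he2 hnp hlam1 hm hj).trans (pow_le_pow_left₀ (inv_nonneg.2 (by linarith)) ?_ j)
  rw [inv_le_comm₀ (by linarith) (by norm_num)]
  linarith

/-- **Products of ratios**: if `|Ξ(m-1-i)/Ξ(m-i) - R| ≤ η` for all `i < j` then
`|Ξ(m-j)/Ξ(m) - Rʲ| ≤ j 2ʲ η` (`j ≤ m ≤ n`, `0 < R ≤ 2`, `λ ≤ 1/2`). [folklore] -/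
theorem gf_abs_r_sub_pow_le (hlam2 : lam ≤ 1 / 2) {R : ℝ} (hR0 : 0 < R) (hR2 : R ≤ 2) {m : ℕ} (hm : m ≤ n)
    {η : ℝ} : ∀ {j : ℕ}, j ≤ m →
      (∀ i < j, |Xi P e n (m - 1 - i) / Xi P e n (m - 1 - i + 1) - R| ≤ η) →
      |Xi P e n (m - j) / Xi P e n m - R ^ j| ≤ j * 2 ^ j * η := by
  intro j
  induction j with
  | zero =>
      intro _ _
      rw [gf_r_zero he he2 hnp hlam1 hm, pow_zero, sub_self, abs_zero]
      simp
  | succ j ih =>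
      intro hj hq
      have hη : 0 ≤ η := (abs_nonneg _).trans (hq j (Nat.lt_succ_self j))
      have ih' := ih (by omega) fun i hi => hq i (Nat.lt_succ_of_lt hi)
      have hqj := hq j (Nat.lt_succ_self j)
      rw [gf_r_succ he he2 hnp hlam1 hm hj, pow_succ]
      set r := Xi P e n (m - j) / Xi P e n m with hr
      set q := Xi P e n (m - 1 - j) / Xi P e n (m - 1 - j + 1) with hq'
      have hrr0 : 0 ≤ r := zero_le_one.trans (gf_one_le_r he he2 hnp hlam1 hm (by omega))
      have hrr2 : r ≤ 2 ^ j := gf_r_le_two_pow he he2 hnp hlam1 hlam2 hm (by omega)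
      have hsplit : r * q - R ^ j * R = r * (q - R) + (r - R ^ j) * R := by ring
      rw [hsplit]
      calc |r * (q - R) + (r - R ^ j) * R|
          ≤ |r * (q - R)| + |(r - R ^ j) * R| := abs_add_le _ _
        _ = r * |q - R| + |r - R ^ j| * R := by
            rw [abs_mul, abs_mul, abs_of_nonneg hrr0, abs_of_pos hR0]
        _ ≤ 2 ^ j * η + (j * 2 ^ j * η) * 2 := by
            gcongr
        _ ≤ (j + 1 : ℕ) * 2 ^ (j + 1) * η := by
            have h2j : (0 : ℝ) ≤ 2 ^ j * η := mul_nonneg (pow_nonneg zero_le_two j) hη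
            push_cast
            rw [pow_succ]
            nlinarith [h2j]

end Bounds

/-! ### Numerics of the slack regime `θ₊ = 2eλ ≤ 1/14` -/

/-- In the slack regime: `0 ≤ θ₊ ≤ 1/14 < 1`, `λ ≤ 1/2`, and the contraction constant `4eθ₊/(1-θ₊)² < 1`.
[folklore] -/
theorem gf_slack_numerics {lam : ℝ} (hlam0 : 0 ≤ lam) (hlam : 2 * Real.exp 1 * lam ≤ 1 / 14) :
    2 * Real.exp 1 * lam < 1 ∧ lam ≤ 1 / 2 ∧
      4 * (Real.exp 1 * (2 * Real.exp 1 * lam) / (1 - 2 * Real.exp 1 * lam) ^ 2) < 1 ∧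
      0 ≤ Real.exp 1 * (2 * Real.exp 1 * lam) / (1 - 2 * Real.exp 1 * lam) ^ 2 := by
  have he1 : Real.exp 1 < 2.7182818286 := Real.exp_one_lt_d9
  have he0 : 0 < Real.exp 1 := Real.exp_pos 1
  have he2 : 1 ≤ Real.exp 1 := by have := Real.add_one_le_exp (1 : ℝ); linarith
  set θ := 2 * Real.exp 1 * lam with hθ
  have hθ0 : 0 ≤ θ := by positivity
  have hθ1 : θ < 1 := by linarith
  refine ⟨hθ1, by nlinarith, ?_, by positivity⟩
  have hden : (13 / 14 : ℝ) ^ 2 ≤ (1 - θ) ^ 2 := pow_le_pow_left₀ (by norm_num) (by linarith) 2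
  have h1 : Real.exp 1 * θ / (1 - θ) ^ 2 ≤ Real.exp 1 * (1 / 14) / (13 / 14) ^ 2 :=
    div_le_div₀ (by positivity) (by nlinarith) (by positivity) hden
  have h2 : 4 * (Real.exp 1 * (1 / 14) / (13 / 14) ^ 2) < 1 := by
    rw [show Real.exp 1 * (1 / 14) / (13 / 14) ^ 2 = Real.exp 1 * 14 / 169 by ring]
    linarith
  linarith

/-! ### The deterministic estimate at a fixed scale -/

section Deterministic

variable {P : DensityProfile} {σ lam e : ℝ} {n : ℕ}

/-- **The deterministic estimate.** At a fixed `(ε, n)` with `n p_ε ≤ λ`, `ovDensity P σ ≤ λ`, `2eλ ≤ 1/14`, for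
`J ≤ m < n`: if `|Ξ(m-1-i)/Ξ(m-i) - R| ≤ η` for `i < J` and `|C(m,j) W¹(j+1) - γ_j ∫β^{j+1}| ≤ τ` for `j ≤ J`
(`R = ratioLimit P σ`), then `|Ξ(m+1)/Ξ(m) - R⁻¹| ≤ (J+1) 2ᴶ τ + κ₊ η + 2 e θ₊^{J+1}/(1-θ₊)`,
`θ₊ = 2eλ`, `κ₊ = eθ₊/(1-θ₊)²`. [folklore] -/
theorem gf_abs_inv_q_sub_inv_le [NeZero n] (hP : SmallDensity P σ) (hlamσ : ovDensity P σ ≤ lam)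
    (hlam : 2 * Real.exp 1 * lam ≤ 1 / 14) (he : 0 ≤ e) (he2 : e < 1 / 2) (hnp : (n : ℝ) * pOv P e ≤ lam)
    {m J : ℕ} (hJ : J ≤ m) (hm : m < n) {η τ : ℝ} (hη : 0 ≤ η) (hτ : 0 ≤ τ)
    (hq : ∀ i < J, |Xi P e n (m - 1 - i) / Xi P e n (m - 1 - i + 1) - ratioLimit P σ| ≤ η)
    (hc : ∀ j ≤ J, |(m.choose j : ℝ) * Wd P e n (fun _ => 1) (j + 1) - coefLim P σ (fun _ => 1) j| ≤ τ) :
    |(Xi P e n m / Xi P e n (m + 1))⁻¹ - (ratioLimit P σ)⁻¹| ≤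
      (J + 1) * 2 ^ J * τ + (Real.exp 1 * (2 * Real.exp 1 * lam) / (1 - 2 * Real.exp 1 * lam) ^ 2) * η +
        2 * (Real.exp 1 * (2 * Real.exp 1 * lam) ^ (J + 1) / (1 - 2 * Real.exp 1 * lam)) := by
  have he0 : 0 < Real.exp 1 := Real.exp_pos 1
  have hlam0 : 0 ≤ lam := gf_lam_nonneg hnp he
  obtain ⟨hθ1, hlam2, -, -⟩ := gf_slack_numerics hlam0 hlam
  have hlam1 : lam < 1 := by linarith
  set θ := 2 * Real.exp 1 * lam with hθdef
  have hθ0 : 0 ≤ θ := by positivity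
  set R := ratioLimit P σ with hR_def
  have hR0 : 0 < R := hP.ratioLimit_pos
  have hR2 : R ≤ 2 := hP.ratioLimit_mem.2
  have hRabs := hP.abs_ratioLimit_le
  have hov0 : 0 ≤ ovDensity P σ := hP.ovDensity_nonneg
  have hgeomθ : geomRatio P σ ≤ θ := by
    rw [geomRatio, hθdef]; exact mul_le_mul_of_nonneg_left hlamσ (by positivity)
  -- the two decompositions
  set a : ℕ → ℝ := fun j => ((m.choose j : ℝ) * Wd P e n (fun _ => 1) (j + 1)) *
    (Xi P e n (m - j) / Xi P e n m) with ha
  set b : ℕ → ℝ := fun j => coefLim P σ (fun _ => 1) j * R ^ j with hb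
  have hsum_b : Summable b := summable_ratioSeries hP.σ_pos hP.σ_lt_half hP.geomRatio_lt_one hRabs
  have hq_eq : (Xi P e n m / Xi P e n (m + 1))⁻¹ = ∑ j ∈ range (J + 1), a j + ∑ j ∈ Ico (J + 1) (m + 1), a j := by
    rw [gf_inv_q_eq_sum hm, Finset.sum_range_add_sum_Ico _ (by omega)]
  have hR_eq : R⁻¹ = ∑ j ∈ range (J + 1), b j + ∑' j, b (j + (J + 1)) := by
    rw [hR_def, hP.inv_ratioLimit_eq, ratioSeries, ← hsum_b.sum_add_tsum_nat_add (J + 1)]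
  -- bounds on the limit coefficients: `|γ_j ∫β^{j+1}| ≤ e (eλ)ʲ`
  have hcl : ∀ j, |coefLim P σ (fun _ => 1) j| ≤ Real.exp 1 * (Real.exp 1 * lam) ^ j := by
    intro j
    have h := abs_coefLim_le (P := P) hP.σ_pos hP.σ_lt_half (g := fun _ => (1 : ℝ)) measurable_const (C := 1)
      (fun _ => by simp) j
    rw [one_mul] at h
    refine h.trans (mul_le_mul_of_nonneg_left (pow_le_pow_left₀ (by positivity) ?_ j) he0.le)
    exact mul_le_mul_of_nonneg_left hlamσ he0.le
  -- head terms
  have hhead : ∀ j ∈ range (J + 1), |a j - b j| ≤ 2 ^ J * τ + Real.exp 1 * ((j : ℝ) * θ ^ j) * η := by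
    intro j hj
    have hjJ : j ≤ J := Nat.lt_succ_iff.mp (mem_range.mp hj)
    set r := Xi P e n (m - j) / Xi P e n m with hr
    have hrr0 : 0 ≤ r := zero_le_one.trans (gf_one_le_r he he2 hnp hlam1 (by omega) (by omega))
    have hrr2 : r ≤ 2 ^ J :=
      (gf_r_le_two_pow he he2 hnp hlam1 hlam2 (by omega) (by omega)).trans (pow_le_pow_right₀ (by norm_num) hjJ)
    have hrrR : |r - R ^ j| ≤ j * 2 ^ j * η :=
      gf_abs_r_sub_pow_le he he2 hnp hlam1 hlam2 hR0 hR2 (by omega : m ≤ n) (by omega) fun i hi => hq i (by omega)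
    have hcj := hc j hjJ
    have hsplit : a j - b j = ((m.choose j : ℝ) * Wd P e n (fun _ => 1) (j + 1) - coefLim P σ (fun _ => 1) j) * r +
        coefLim P σ (fun _ => 1) j * (r - R ^ j) := by
      simp only [ha, hb]; ring
    rw [hsplit]
    calc |((m.choose j : ℝ) * Wd P e n (fun _ => 1) (j + 1) - coefLim P σ (fun _ => 1) j) * r +
          coefLim P σ (fun _ => 1) j * (r - R ^ j)|
        ≤ |(m.choose j : ℝ) * Wd P e n (fun _ => 1) (j + 1) - coefLim P σ (fun _ => 1) j| * r +
          |coefLim P σ (fun _ => 1) j| * |r - R ^ j| := by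
          refine (abs_add_le _ _).trans (le_of_eq ?_)
          rw [abs_mul, abs_mul, abs_of_nonneg hrr0]
      _ ≤ τ * 2 ^ J + (Real.exp 1 * (Real.exp 1 * lam) ^ j) * (j * 2 ^ j * η) :=
          add_le_add (mul_le_mul hcj hrr2 hrr0 hτ) (mul_le_mul (hcl j) hrrR (abs_nonneg _) (by positivity))
      _ = 2 ^ J * τ + Real.exp 1 * ((j : ℝ) * θ ^ j) * η := by
          rw [hθdef, show (2 * Real.exp 1 * lam) ^ j = 2 ^ j * (Real.exp 1 * lam) ^ j by
            rw [← mul_pow]; ring_nf]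
          ring
  have hκ : Real.exp 1 * ∑ j ∈ range (J + 1), (j : ℝ) * θ ^ j ≤ Real.exp 1 * θ / (1 - θ) ^ 2 := by
    have h := hasSum_coe_mul_geometric_of_norm_lt_one (𝕜 := ℝ) (r := θ)
      (by rw [Real.norm_eq_abs, abs_of_nonneg hθ0]; exact hθ1)
    rw [mul_div_assoc]
    exact mul_le_mul_of_nonneg_left (sum_le_hasSum _ (fun j _ => by positivity) h) he0.le
  have hhead_sum : |∑ j ∈ range (J + 1), (a j - b j)| ≤
      (J + 1) * 2 ^ J * τ + (Real.exp 1 * θ / (1 - θ) ^ 2) * η := by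
    refine (abs_sum_le_sum_abs _ _).trans ((sum_le_sum hhead).trans ?_)
    have hs : ∑ j ∈ range (J + 1), (2 ^ J * τ + Real.exp 1 * ((j : ℝ) * θ ^ j) * η) =
        (J + 1) * 2 ^ J * τ + (Real.exp 1 * ∑ j ∈ range (J + 1), (j : ℝ) * θ ^ j) * η := by
      rw [sum_add_distrib, sum_const, card_range, nsmul_eq_mul, Finset.mul_sum, Finset.sum_mul]
      push_cast
      ring
    rw [hs]
    nlinarith
  -- geometric tails
  have hgeo_tail : ∀ K : ℕ, Real.exp 1 * ∑ j ∈ Ico (J + 1) K, θ ^ j ≤ Real.exp 1 * θ ^ (J + 1) / (1 - θ) := by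
    intro K
    rw [mul_div_assoc]
    refine mul_le_mul_of_nonneg_left ?_ he0.le
    rw [Finset.sum_Ico_eq_sum_range]
    have h := (hasSum_geometric_of_lt_one hθ0 hθ1).mul_left (θ ^ (J + 1))
    rw [← div_eq_mul_inv] at h
    refine le_trans (le_of_eq ?_) (sum_le_hasSum (range (K - (J + 1))) (fun j _ => by positivity) h)
    exact sum_congr rfl fun j _ => by rw [pow_add]
  have htail_a : |∑ j ∈ Ico (J + 1) (m + 1), a j| ≤ Real.exp 1 * θ ^ (J + 1) / (1 - θ) := by
    refine (abs_sum_le_sum_abs _ _).trans ?_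
    have hterm : ∀ j ∈ Ico (J + 1) (m + 1), |a j| ≤ Real.exp 1 * θ ^ j := by
      intro j hj
      have hjm : j ≤ m := Nat.lt_succ_iff.mp (mem_Ico.mp hj).2
      have hrr0 : 0 ≤ Xi P e n (m - j) / Xi P e n m :=
        zero_le_one.trans (gf_one_le_r he he2 hnp hlam1 (by omega) hjm)
      have hrr2 : Xi P e n (m - j) / Xi P e n m ≤ 2 ^ j := gf_r_le_two_pow he he2 hnp hlam1 hlam2 (by omega) hjm
      have hco := gf_abs_coef_le (P := P) he he2 hnp (g := fun _ => (1 : ℝ)) measurable_const (C := 1)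
        (fun _ => by simp) (m := m) (j := j) (by omega) (by omega)
      rw [one_mul] at hco
      simp only [ha, abs_mul, abs_of_nonneg hrr0]
      rw [← abs_mul]
      calc |(m.choose j : ℝ) * Wd P e n (fun _ => 1) (j + 1)| * (Xi P e n (m - j) / Xi P e n m)
          ≤ (Real.exp 1 * (Real.exp 1 * lam) ^ j) * 2 ^ j := mul_le_mul hco hrr2 hrr0 (by positivity)
        _ = Real.exp 1 * θ ^ j := by rw [hθdef, mul_assoc, ← mul_pow]; ring_nf
    refine (sum_le_sum hterm).trans ?_
    rw [← mul_sum]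
    exact hgeo_tail (m + 1)
  have htail_b : |∑' j, b (j + (J + 1))| ≤ Real.exp 1 * θ ^ (J + 1) / (1 - θ) := by
    refine (hP.abs_tsum_tail_le J).trans ?_
    rw [geomTail]
    have hg0 := hP.geomRatio_nonneg
    have hg1 := hP.geomRatio_lt_one
    exact div_le_div₀ (by positivity) (mul_le_mul_of_nonneg_left (pow_le_pow_left₀ hg0 hgeomθ _) he0.le)
      (by linarith) (by linarith)
  -- assemble
  have hdiff : (Xi P e n m / Xi P e n (m + 1))⁻¹ - R⁻¹ = ∑ j ∈ range (J + 1), (a j - b j) +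
      ∑ j ∈ Ico (J + 1) (m + 1), a j - ∑' j, b (j + (J + 1)) := by
    rw [hq_eq, hR_eq, sum_sub_distrib]; ring
  rw [hdiff]
  have h3 : ∀ x y z : ℝ, |x + y - z| ≤ |x| + |y| + |z| := fun x y z =>
    (abs_sub _ _).trans (by gcongr; exact abs_add_le x y)
  refine (h3 _ _ _).trans ?_
  rw [hθdef] at hhead_sum htail_a htail_b
  linarith

end Deterministic

/-! ### Registered helper -/

/-- **Registered helper `gf_helper_deterministic`** (sub-goal of `stub_concentrationGeneralFamilies`): the deterministic
estimate `gf_abs_inv_q_sub_inv_le` in closed form. [folklore] -/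
theorem gf_helper_deterministic :
    ∀ {P : Literature.MathematicalPhysics.KineticTheory.DensityProfile} {σ lam e : ℝ} {n : ℕ} [NeZero n],
      Literature.MathematicalPhysics.KineticTheory.SmallDensity P σ →
      Literature.MathematicalPhysics.KineticTheory.ovDensity P σ ≤ lam → 2 * Real.exp 1 * lam ≤ 1 / 14 →
      0 ≤ e → e < 1 / 2 → (n : ℝ) * Literature.MathematicalPhysics.KineticTheory.pOv P e ≤ lam →
      ∀ {m J : ℕ}, J ≤ m → m < n → ∀ {η τ : ℝ}, 0 ≤ η → 0 ≤ τ →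
      (∀ i < J, |Literature.MathematicalPhysics.KineticTheory.Xi P e n (m - 1 - i) /
          Literature.MathematicalPhysics.KineticTheory.Xi P e n (m - 1 - i + 1) -
          Literature.MathematicalPhysics.KineticTheory.ratioLimit P σ| ≤ η) →
      (∀ j ≤ J, |(m.choose j : ℝ) * Literature.MathematicalPhysics.KineticTheory.Wd P e n (fun _ => 1) (j + 1) -
          Literature.MathematicalPhysics.KineticTheory.coefLim P σ (fun _ => 1) j| ≤ τ) →
      |(Literature.MathematicalPhysics.KineticTheory.Xi P e n m /
          Literature.MathematicalPhysics.KineticTheory.Xi P e n (m + 1))⁻¹ -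
          (Literature.MathematicalPhysics.KineticTheory.ratioLimit P σ)⁻¹| ≤
        (J + 1) * 2 ^ J * τ + (Real.exp 1 * (2 * Real.exp 1 * lam) / (1 - 2 * Real.exp 1 * lam) ^ 2) * η +
          2 * (Real.exp 1 * (2 * Real.exp 1 * lam) ^ (J + 1) / (1 - 2 * Real.exp 1 * lam)) :=
  fun hP hlamσ hlam he he2 hnp _ _ hJ hm _ _ hη hτ hq hc =>
    gf_abs_inv_q_sub_inv_le hP hlamσ hlam he he2 hnp hJ hm hη hτ hq hc

end Summit.AtomisticToContinuum.HydrodynamicLimit.Theorems.NearConstantShortTimeHL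

end
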